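import Summits.HodgeConjecture.HodgeConjecture.Theorems.Ring2WeilCoverageCMFieldRowsA
import Summits.HodgeConjecture.HodgeConjecture.Theorems.Ring2WeilCoverageCMFieldNonGalois
import Summits.HodgeConjecture.HodgeConjecture.Theorems.Ring2WeilCoverageCMFieldDegreeOnePrimesGeneral
import HarnessLib

/-!
# Weil-type components over quartic CM fields, VIII (part E): the ROW STRUCTURE of the integer classes
# `n ≤ 40` — which discriminant classes label the SAME component (`ℚ(√-(3+√2))`, non-Galois)

research route conditional on HC_CM; not a corollary; Q11.4-sentence-2 already refuted in dim ≥ 3. Cell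
`pub-hodge-ring2`, seat `ring2-b03` (gen 50); kernel form of the `T`-set column of the Weil-type family-coverage
census `HOME/WEIL-FAMILY-COVERAGE.md` §b03.5 — companion of part A (`Ring2WeilCoverageCMFieldRowsA`, which has the
generic §0: `mk_eq_mk_of_mk_mul_eq_split`, `mk_ne_mk_of_mk_mul_ne_split`, `mk_eq_mk_iff_of_rowMap`). For
`E = F(√σ)`, `F = ℚ[S]/(R)`, `R = S² + pS + q` on Deligne's carriers, the components `W8.E.δ` at `g = 8` are indexed
by `δ ∈ F^×/Nm_{E/F}(E^×)` (`cmNormResidueGroup R`); here, for the `D₄` field `E = ℚ(√-(3+√2))` (`R = S² + 6S + 7`, class number 2; 10 rows among `n ≤ 40`; the pair `([3], [17])` needs the half-split prime `17`, i.e. the general degree-one engine `Ring2WeilCoverageCMFieldDegreeOnePrimesGeneral` of this gen): `X_rowMap` (`[n] = [r(n)]`, `r(n)` the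
least positive integer on the row of `[n]`, one norm witness for `n·r(n)` per entry), `X_reps_pairwise_ne` (one
obstruction certificate of gens 46–48 per product `r₁r₂`), `X_mk_eq_mk_iff_sameRow` (`[n₁] = [n₂] ↔ r(n₁) = r(n₂)`,
`1 ≤ n₁, n₂ ≤ 40`). The graphs agree with the `T`-sets of census §b03.5 (PARI + stdlib, ×2 by ring2-b06).

No named fact, no definition, no `sorry`; nothing about the Hodge conjecture is asserted: the theorems say which
discriminant classes index the same Weil-type component (Deligne Cor. 4.2 / Landherr), whose general member is
OPEN on every row (census §b03.2). References: [Deligne1982HodgeCycles] §4 p. 30 (1), Cor. 4.2, Lemma 4.6;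
[Landherr1936HermitianForms]. -/

noncomputable section

set_option linter.dupNamespace false

open Polynomial

namespace Summit.HodgeConjecture.HodgeConjecture.Ring2.WeilCoverageCM

open Literature.AlgebraicGeometry.Deligne1982
open Literature.AlgebraicGeometry.HodgeTheory (splitDiscriminantClassCM)

/-! ### `E = ℚ(√-(3+√2))`, `R = S² + 6S + 7`: 10 rows among `1 ≤ n ≤ 40` — representatives `[1, 3, 5, 11, 13, 15, 17, 23, 33, 39]` -/

section SqrtNegThreePlusSqrtTwo

variable {R : Polynomial ℤ} (hR : R = X ^ 2 + C 6 * X + C 7) [Fact (Irreducible (realPolyQ R))]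
include hR

/-- **ROW MAP for `E = ℚ(√-(3+√2))` (`R = S² + 6S + 7`), `1 ≤ n ≤ 40`: `[n] = [r(n)]` in `F^×/Nm_{E/F}(E^×)`, `r(n)`
= the least positive integer on the row of `[n]`** — the displayed set is the graph of `r` (split entries `r = 1`;
non-split rows: [3] ∋ 3, 6, 7, 12, 14, 19, 24, 27, 28, 31, 38; [5] ∋ 5, 10, 20, 40; [11] ∋ 11, 22; [13] ∋ 13, 26;
[15] ∋ 15, 30, 35; [17] ∋ 17, 34; [23] ∋ 23; [33] ∋ 33; [39] ∋ 39). Each case is a norm witness `(A + Bσ)² - σ(C +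
Dσ)² = n·r(n)·m²` (`[n·r(n)] = [1] ⇒ [n] = [r(n)]`), or `u = v`. Agrees with the `T`-sets of census §b03.5 (PARI +
stdlib ×2 + ring2-b06's third code). [cite: Deligne1982HodgeCycles, §4 p. 30 (1) and Cor. 4.2] -/
theorem sqrtNegThreePlusSqrtTwo_rowMap (n r : ℕ)
    (h : (n, r) ∈ (
      {(1, 1), (2, 1), (3, 3), (4, 1), (5, 5), (6, 3), (7, 3), (8, 1), (9, 1), (10, 5), (11, 11), (12, 3),
       (13, 13), (14, 3), (15, 15), (16, 1), (17, 17), (18, 1), (19, 3), (20, 5), (21, 1), (22, 11), (23, 23),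
       (24, 3), (25, 1), (26, 13), (27, 3), (28, 3), (29, 1), (30, 15), (31, 3), (32, 1), (33, 33), (34, 17),
       (35, 15), (36, 1), (37, 1), (38, 3), (39, 39), (40, 5)} : Finset (ℕ × ℕ)))
    (u v : (realField R)ˣ) (hu : (u : realField R) = n) (hv : (v : realField R) = r) :
    (QuotientGroup.mk u : cmNormResidueGroup R) = QuotientGroup.mk v := by
  haveI := fact_irreducible_cmPolyQ_of_pos hR (by norm_num) (by norm_num) disc_not_sq_six_seven
  simp only [Finset.mem_insert, Finset.mem_singleton, Prod.mk.injEq] at h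
  rcases h with ⟨rfl, rfl⟩ | ⟨rfl, rfl⟩ | ⟨rfl, rfl⟩ | ⟨rfl, rfl⟩ | ⟨rfl, rfl⟩ | ⟨rfl, rfl⟩ | ⟨rfl, rfl⟩ | ⟨rfl, rfl⟩ | ⟨rfl, rfl⟩ | ⟨rfl, rfl⟩ |
    ⟨rfl, rfl⟩ | ⟨rfl, rfl⟩ | ⟨rfl, rfl⟩ | ⟨rfl, rfl⟩ | ⟨rfl, rfl⟩ | ⟨rfl, rfl⟩ | ⟨rfl, rfl⟩ | ⟨rfl, rfl⟩ | ⟨rfl, rfl⟩ | ⟨rfl, rfl⟩ |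
    ⟨rfl, rfl⟩ | ⟨rfl, rfl⟩ | ⟨rfl, rfl⟩ | ⟨rfl, rfl⟩ | ⟨rfl, rfl⟩ | ⟨rfl, rfl⟩ | ⟨rfl, rfl⟩ | ⟨rfl, rfl⟩ | ⟨rfl, rfl⟩ | ⟨rfl, rfl⟩ |
    ⟨rfl, rfl⟩ | ⟨rfl, rfl⟩ | ⟨rfl, rfl⟩ | ⟨rfl, rfl⟩ | ⟨rfl, rfl⟩ | ⟨rfl, rfl⟩ | ⟨rfl, rfl⟩ | ⟨rfl, rfl⟩ | ⟨rfl, rfl⟩ | ⟨rfl, rfl⟩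
  · rw [Units.ext (hu.trans hv.symm : (u : realField R) = v)]
  · exact mk_eq_mk_of_mk_mul_eq_split u v (mk_eq_splitDiscriminantClassCM_two_of_coords_of_pos hR (by norm_num) (by norm_num)
      disc_not_sq_six_seven 2 3 1 0 0 1 one_ne_zero (by norm_num) (by norm_num) (u * v) (by rw [Units.val_mul, hu, hv]; norm_num))
  · rw [Units.ext (hu.trans hv.symm : (u : realField R) = v)]
  · exact mk_eq_mk_of_mk_mul_eq_split u v (mk_eq_splitDiscriminantClassCM_two_of_coords_of_pos hR (by norm_num) (by norm_num)
      disc_not_sq_six_seven 4 2 0 0 0 1 one_ne_zero (by norm_num) (by norm_num) (u * v) (by rw [Units.val_mul, hu, hv]; norm_num))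
  · rw [Units.ext (hu.trans hv.symm : (u : realField R) = v)]
  · exact mk_eq_mk_of_mk_mul_eq_split u v (mk_eq_splitDiscriminantClassCM_two_of_coords_of_pos hR (by norm_num) (by norm_num)
      disc_not_sq_six_seven 18 5 1 2 0 1 one_ne_zero (by norm_num) (by norm_num) (u * v) (by rw [Units.val_mul, hu, hv]; norm_num))
  · exact mk_eq_mk_of_mk_mul_eq_split u v (mk_eq_splitDiscriminantClassCM_two_of_coords_of_pos hR (by norm_num) (by norm_num)
      disc_not_sq_six_seven 21 0 1 5 1 1 one_ne_zero (by norm_num) (by norm_num) (u * v) (by rw [Units.val_mul, hu, hv]; norm_num))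
  · exact mk_eq_mk_of_mk_mul_eq_split u v (mk_eq_splitDiscriminantClassCM_two_of_coords_of_pos hR (by norm_num) (by norm_num)
      disc_not_sq_six_seven 8 6 2 0 0 1 one_ne_zero (by norm_num) (by norm_num) (u * v) (by rw [Units.val_mul, hu, hv]; norm_num))
  · exact mk_eq_mk_of_mk_mul_eq_split u v (mk_eq_splitDiscriminantClassCM_two_of_coords_of_pos hR (by norm_num) (by norm_num)
      disc_not_sq_six_seven 9 3 0 0 0 1 one_ne_zero (by norm_num) (by norm_num) (u * v) (by rw [Units.val_mul, hu, hv]; norm_num))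
  · exact mk_eq_mk_of_mk_mul_eq_split u v (mk_eq_splitDiscriminantClassCM_two_of_coords_of_pos hR (by norm_num) (by norm_num)
      disc_not_sq_six_seven 50 15 5 0 0 1 one_ne_zero (by norm_num) (by norm_num) (u * v) (by rw [Units.val_mul, hu, hv]; norm_num))
  · rw [Units.ext (hu.trans hv.symm : (u : realField R) = v)]
  · exact mk_eq_mk_of_mk_mul_eq_split u v (mk_eq_splitDiscriminantClassCM_two_of_coords_of_pos hR (by norm_num) (by norm_num)
      disc_not_sq_six_seven 36 6 0 0 0 1 one_ne_zero (by norm_num) (by norm_num) (u * v) (by rw [Units.val_mul, hu, hv]; norm_num))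
  · rw [Units.ext (hu.trans hv.symm : (u : realField R) = v)]
  · exact mk_eq_mk_of_mk_mul_eq_split u v (mk_eq_splitDiscriminantClassCM_two_of_coords_of_pos hR (by norm_num) (by norm_num)
      disc_not_sq_six_seven 42 7 1 6 2 1 one_ne_zero (by norm_num) (by norm_num) (u * v) (by rw [Units.val_mul, hu, hv]; norm_num))
  · rw [Units.ext (hu.trans hv.symm : (u : realField R) = v)]
  · exact mk_eq_mk_of_mk_mul_eq_split u v (mk_eq_splitDiscriminantClassCM_two_of_coords_of_pos hR (by norm_num) (by norm_num)
      disc_not_sq_six_seven 16 4 0 0 0 1 one_ne_zero (by norm_num) (by norm_num) (u * v) (by rw [Units.val_mul, hu, hv]; norm_num))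
  · rw [Units.ext (hu.trans hv.symm : (u : realField R) = v)]
  · exact mk_eq_mk_of_mk_mul_eq_split u v (mk_eq_splitDiscriminantClassCM_two_of_coords_of_pos hR (by norm_num) (by norm_num)
      disc_not_sq_six_seven 18 5 1 2 0 1 one_ne_zero (by norm_num) (by norm_num) (u * v) (by rw [Units.val_mul, hu, hv]; norm_num))
  · exact mk_eq_mk_of_mk_mul_eq_split u v (mk_eq_splitDiscriminantClassCM_two_of_coords_of_pos hR (by norm_num) (by norm_num)
      disc_not_sq_six_seven 57 8 3 7 1 1 one_ne_zero (by norm_num) (by norm_num) (u * v) (by rw [Units.val_mul, hu, hv]; norm_num))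
  · exact mk_eq_mk_of_mk_mul_eq_split u v (mk_eq_splitDiscriminantClassCM_two_of_coords_of_pos hR (by norm_num) (by norm_num)
      disc_not_sq_six_seven 100 10 0 0 0 1 one_ne_zero (by norm_num) (by norm_num) (u * v) (by rw [Units.val_mul, hu, hv]; norm_num))
  · exact mk_eq_mk_of_mk_mul_eq_split u v (mk_eq_splitDiscriminantClassCM_two_of_coords_of_pos hR (by norm_num) (by norm_num)
      disc_not_sq_six_seven 21 0 1 5 1 1 one_ne_zero (by norm_num) (by norm_num) (u * v) (by rw [Units.val_mul, hu, hv]; norm_num))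
  · exact mk_eq_mk_of_mk_mul_eq_split u v (mk_eq_splitDiscriminantClassCM_two_of_coords_of_pos hR (by norm_num) (by norm_num)
      disc_not_sq_six_seven 242 33 11 0 0 1 one_ne_zero (by norm_num) (by norm_num) (u * v) (by rw [Units.val_mul, hu, hv]; norm_num))
  · rw [Units.ext (hu.trans hv.symm : (u : realField R) = v)]
  · exact mk_eq_mk_of_mk_mul_eq_split u v (mk_eq_splitDiscriminantClassCM_two_of_coords_of_pos hR (by norm_num) (by norm_num)
      disc_not_sq_six_seven 72 10 2 4 0 1 one_ne_zero (by norm_num) (by norm_num) (u * v) (by rw [Units.val_mul, hu, hv]; norm_num))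
  · exact mk_eq_mk_of_mk_mul_eq_split u v (mk_eq_splitDiscriminantClassCM_two_of_coords_of_pos hR (by norm_num) (by norm_num)
      disc_not_sq_six_seven 25 5 0 0 0 1 one_ne_zero (by norm_num) (by norm_num) (u * v) (by rw [Units.val_mul, hu, hv]; norm_num))
  · exact mk_eq_mk_of_mk_mul_eq_split u v (mk_eq_splitDiscriminantClassCM_two_of_coords_of_pos hR (by norm_num) (by norm_num)
      disc_not_sq_six_seven 338 39 13 0 0 1 one_ne_zero (by norm_num) (by norm_num) (u * v) (by rw [Units.val_mul, hu, hv]; norm_num))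
  · exact mk_eq_mk_of_mk_mul_eq_split u v (mk_eq_splitDiscriminantClassCM_two_of_coords_of_pos hR (by norm_num) (by norm_num)
      disc_not_sq_six_seven 81 9 0 0 0 1 one_ne_zero (by norm_num) (by norm_num) (u * v) (by rw [Units.val_mul, hu, hv]; norm_num))
  · exact mk_eq_mk_of_mk_mul_eq_split u v (mk_eq_splitDiscriminantClassCM_two_of_coords_of_pos hR (by norm_num) (by norm_num)
      disc_not_sq_six_seven 84 0 2 10 2 1 one_ne_zero (by norm_num) (by norm_num) (u * v) (by rw [Units.val_mul, hu, hv]; norm_num))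
  · exact mk_eq_mk_of_mk_mul_eq_split u v (mk_eq_splitDiscriminantClassCM_two_of_coords_of_pos hR (by norm_num) (by norm_num)
      disc_not_sq_six_seven 29 8 3 5 1 1 one_ne_zero (by norm_num) (by norm_num) (u * v) (by rw [Units.val_mul, hu, hv]; norm_num))
  · exact mk_eq_mk_of_mk_mul_eq_split u v (mk_eq_splitDiscriminantClassCM_two_of_coords_of_pos hR (by norm_num) (by norm_num)
      disc_not_sq_six_seven 450 25 5 10 0 1 one_ne_zero (by norm_num) (by norm_num) (u * v) (by rw [Units.val_mul, hu, hv]; norm_num))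
  · exact mk_eq_mk_of_mk_mul_eq_split u v (mk_eq_splitDiscriminantClassCM_two_of_coords_of_pos hR (by norm_num) (by norm_num)
      disc_not_sq_six_seven 93 4 1 9 1 1 one_ne_zero (by norm_num) (by norm_num) (u * v) (by rw [Units.val_mul, hu, hv]; norm_num))
  · exact mk_eq_mk_of_mk_mul_eq_split u v (mk_eq_splitDiscriminantClassCM_two_of_coords_of_pos hR (by norm_num) (by norm_num)
      disc_not_sq_six_seven 32 12 4 0 0 1 one_ne_zero (by norm_num) (by norm_num) (u * v) (by rw [Units.val_mul, hu, hv]; norm_num))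
  · rw [Units.ext (hu.trans hv.symm : (u : realField R) = v)]
  · exact mk_eq_mk_of_mk_mul_eq_split u v (mk_eq_splitDiscriminantClassCM_two_of_coords_of_pos hR (by norm_num) (by norm_num)
      disc_not_sq_six_seven 578 9 (-3) 22 4 1 one_ne_zero (by norm_num) (by norm_num) (u * v) (by rw [Units.val_mul, hu, hv]; norm_num))
  · exact mk_eq_mk_of_mk_mul_eq_split u v (mk_eq_splitDiscriminantClassCM_two_of_coords_of_pos hR (by norm_num) (by norm_num)
      disc_not_sq_six_seven 525 0 5 25 5 1 one_ne_zero (by norm_num) (by norm_num) (u * v) (by rw [Units.val_mul, hu, hv]; norm_num))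
  · exact mk_eq_mk_of_mk_mul_eq_split u v (mk_eq_splitDiscriminantClassCM_two_of_coords_of_pos hR (by norm_num) (by norm_num)
      disc_not_sq_six_seven 36 6 0 0 0 1 one_ne_zero (by norm_num) (by norm_num) (u * v) (by rw [Units.val_mul, hu, hv]; norm_num))
  · exact mk_eq_mk_of_mk_mul_eq_split u v (mk_eq_splitDiscriminantClassCM_two_of_coords_of_pos hR (by norm_num) (by norm_num)
      disc_not_sq_six_seven 37 3 2 8 2 1 one_ne_zero (by norm_num) (by norm_num) (u * v) (by rw [Units.val_mul, hu, hv]; norm_num))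
  · exact mk_eq_mk_of_mk_mul_eq_split u v (mk_eq_splitDiscriminantClassCM_two_of_coords_of_pos hR (by norm_num) (by norm_num)
      disc_not_sq_six_seven 114 11 1 4 0 1 one_ne_zero (by norm_num) (by norm_num) (u * v) (by rw [Units.val_mul, hu, hv]; norm_num))
  · rw [Units.ext (hu.trans hv.symm : (u : realField R) = v)]
  · exact mk_eq_mk_of_mk_mul_eq_split u v (mk_eq_splitDiscriminantClassCM_two_of_coords_of_pos hR (by norm_num) (by norm_num)
      disc_not_sq_six_seven 200 30 10 0 0 1 one_ne_zero (by norm_num) (by norm_num) (u * v) (by rw [Units.val_mul, hu, hv]; norm_num))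

/-- **The 10 rows met by `1 ≤ n ≤ 40` for `E = ℚ(√-(3+√2))` are PAIRWISE DISTINCT**: `[r₁] ≠ [r₂]` for `r₁ < r₂` in
`{1, 3, 5, 11, 13, 15, 17, 23, 33, 39}` — each by an obstruction certificate for the product `r₁r₂` (`[r₁r₂] ≠ [1] ⇒
[r₁] ≠ [r₂]`; local obstruction at an inert / ramified / degree-one place, gens 46–48 lemmas, and for `([3], [17])`
— `[51]`, `T = {(√2), (17, √2+6)}` — the general degree-one engine of
`Ring2WeilCoverageCMFieldDegreeOnePrimesGeneral` at `π = 11 + 2σ`). [cite: Deligne1982HodgeCycles, §4 p. 30 (1) and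
Cor. 4.2] -/
theorem sqrtNegThreePlusSqrtTwo_reps_pairwise_ne (r₁ r₂ : ℕ) (h₁ : r₁ ∈ ({1, 3, 5, 11, 13, 15, 17, 23, 33, 39} : Finset ℕ))
    (h₂ : r₂ ∈ ({1, 3, 5, 11, 13, 15, 17, 23, 33, 39} : Finset ℕ)) (hlt : r₁ < r₂)
    (u v : (realField R)ˣ) (hu : (u : realField R) = r₁) (hv : (v : realField R) = r₂) :
    (QuotientGroup.mk u : cmNormResidueGroup R) ≠ QuotientGroup.mk v := by
  haveI := fact_irreducible_cmPolyQ_of_pos hR (by norm_num) (by norm_num) disc_not_sq_six_seven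
  simp only [Finset.mem_insert, Finset.mem_singleton] at h₁ h₂
  rcases h₁ with rfl | rfl | rfl | rfl | rfl | rfl | rfl | rfl | rfl | rfl <;> rcases h₂ with rfl | rfl | rfl | rfl | rfl | rfl | rfl | rfl | rfl | rfl <;> try omega
  · exact mk_ne_mk_of_mk_mul_ne_split u v (sqrtNegThreePlusSqrtTwo_mk_ne_splitDiscriminantClassCM_of_residue hR 3 (by decide) (u * v) (by rw [Units.val_mul, hu, hv]; norm_num))
  · exact mk_ne_mk_of_mk_mul_ne_split u v (sqrtNegThreePlusSqrtTwo_mk_five_mul_ne_splitDiscriminantClassCM hR 1 (by norm_num) (u * v) (by rw [Units.val_mul, hu, hv]; norm_num))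
  · exact mk_ne_mk_of_mk_mul_ne_split u v (sqrtNegThreePlusSqrtTwo_mk_eleven_mul_ne_splitDiscriminantClassCM hR 1 (by norm_num) (u * v) (by rw [Units.val_mul, hu, hv]; norm_num))
  · exact mk_ne_mk_of_mk_mul_ne_split u v (sqrtNegThreePlusSqrtTwo_mk_thirteen_mul_ne_splitDiscriminantClassCM hR 1 (by norm_num) (u * v) (by rw [Units.val_mul, hu, hv]; norm_num))
  · exact mk_ne_mk_of_mk_mul_ne_split u v (sqrtNegThreePlusSqrtTwo_mk_five_mul_ne_splitDiscriminantClassCM hR 3 (by norm_num) (u * v) (by rw [Units.val_mul, hu, hv]; norm_num))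
  · exact mk_ne_mk_of_mk_mul_ne_split u v (sqrtNegThreePlusSqrtTwo_mk_ne_splitDiscriminantClassCM_of_residue hR 17 (by decide) (u * v) (by rw [Units.val_mul, hu, hv]; norm_num))
  · exact mk_ne_mk_of_mk_mul_ne_split u v (sqrtNegThreePlusSqrtTwo_mk_twentyThree_mul_ne_splitDiscriminantClassCM hR 1 (by norm_num) (u * v) (by rw [Units.val_mul, hu, hv]; norm_num))
  · exact mk_ne_mk_of_mk_mul_ne_split u v (sqrtNegThreePlusSqrtTwo_mk_eleven_mul_ne_splitDiscriminantClassCM hR 3 (by norm_num) (u * v) (by rw [Units.val_mul, hu, hv]; norm_num))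
  · exact mk_ne_mk_of_mk_mul_ne_split u v (sqrtNegThreePlusSqrtTwo_mk_thirteen_mul_ne_splitDiscriminantClassCM hR 3 (by norm_num) (u * v) (by rw [Units.val_mul, hu, hv]; norm_num))
  · exact mk_ne_mk_of_mk_mul_ne_split u v (sqrtNegThreePlusSqrtTwo_mk_five_mul_ne_splitDiscriminantClassCM hR 3 (by norm_num) (u * v) (by rw [Units.val_mul, hu, hv]; norm_num))
  · exact mk_ne_mk_of_mk_mul_ne_split u v (sqrtNegThreePlusSqrtTwo_mk_eleven_mul_ne_splitDiscriminantClassCM hR 3 (by norm_num) (u * v) (by rw [Units.val_mul, hu, hv]; norm_num))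
  · exact mk_ne_mk_of_mk_mul_ne_split u v (sqrtNegThreePlusSqrtTwo_mk_thirteen_mul_ne_splitDiscriminantClassCM hR 3 (by norm_num) (u * v) (by rw [Units.val_mul, hu, hv]; norm_num))
  · exact mk_ne_mk_of_mk_mul_ne_split u v (sqrtNegThreePlusSqrtTwo_mk_five_mul_ne_splitDiscriminantClassCM hR 9 (by norm_num) (u * v) (by rw [Units.val_mul, hu, hv]; norm_num))
  · exact mk_ne_mk_of_mk_mul_ne_split u v (sqrtNegThreePlusSqrtTwo_mk_seventeen_mul_ne_splitDiscriminantClassCM hR 3 (by norm_num) (u * v) (by rw [Units.val_mul, hu, hv]; norm_num))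
  · exact mk_ne_mk_of_mk_mul_ne_split u v (sqrtNegThreePlusSqrtTwo_mk_twentyThree_mul_ne_splitDiscriminantClassCM hR 3 (by norm_num) (u * v) (by rw [Units.val_mul, hu, hv]; norm_num))
  · exact mk_ne_mk_of_mk_mul_ne_split u v (sqrtNegThreePlusSqrtTwo_mk_eleven_mul_ne_splitDiscriminantClassCM hR 9 (by norm_num) (u * v) (by rw [Units.val_mul, hu, hv]; norm_num))
  · exact mk_ne_mk_of_mk_mul_ne_split u v (sqrtNegThreePlusSqrtTwo_mk_thirteen_mul_ne_splitDiscriminantClassCM hR 9 (by norm_num) (u * v) (by rw [Units.val_mul, hu, hv]; norm_num))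
  · exact mk_ne_mk_of_mk_mul_ne_split u v (sqrtNegThreePlusSqrtTwo_mk_five_mul_ne_splitDiscriminantClassCM hR 11 (by norm_num) (u * v) (by rw [Units.val_mul, hu, hv]; norm_num))
  · exact mk_ne_mk_of_mk_mul_ne_split u v (sqrtNegThreePlusSqrtTwo_mk_five_mul_ne_splitDiscriminantClassCM hR 13 (by norm_num) (u * v) (by rw [Units.val_mul, hu, hv]; norm_num))
  · exact mk_ne_mk_of_mk_mul_ne_split u v (sqrtNegThreePlusSqrtTwo_mk_ne_splitDiscriminantClassCM_of_residue hR 75 (by decide) (u * v) (by rw [Units.val_mul, hu, hv]; norm_num))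
  · exact mk_ne_mk_of_mk_mul_ne_split u v (sqrtNegThreePlusSqrtTwo_mk_five_mul_ne_splitDiscriminantClassCM hR 17 (by norm_num) (u * v) (by rw [Units.val_mul, hu, hv]; norm_num))
  · exact mk_ne_mk_of_mk_mul_ne_split u v (sqrtNegThreePlusSqrtTwo_mk_five_mul_ne_splitDiscriminantClassCM hR 23 (by norm_num) (u * v) (by rw [Units.val_mul, hu, hv]; norm_num))
  · exact mk_ne_mk_of_mk_mul_ne_split u v (sqrtNegThreePlusSqrtTwo_mk_five_mul_ne_splitDiscriminantClassCM hR 33 (by norm_num) (u * v) (by rw [Units.val_mul, hu, hv]; norm_num))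
  · exact mk_ne_mk_of_mk_mul_ne_split u v (sqrtNegThreePlusSqrtTwo_mk_five_mul_ne_splitDiscriminantClassCM hR 39 (by norm_num) (u * v) (by rw [Units.val_mul, hu, hv]; norm_num))
  · exact mk_ne_mk_of_mk_mul_ne_split u v (sqrtNegThreePlusSqrtTwo_mk_eleven_mul_ne_splitDiscriminantClassCM hR 13 (by norm_num) (u * v) (by rw [Units.val_mul, hu, hv]; norm_num))
  · exact mk_ne_mk_of_mk_mul_ne_split u v (sqrtNegThreePlusSqrtTwo_mk_five_mul_ne_splitDiscriminantClassCM hR 33 (by norm_num) (u * v) (by rw [Units.val_mul, hu, hv]; norm_num))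
  · exact mk_ne_mk_of_mk_mul_ne_split u v (sqrtNegThreePlusSqrtTwo_mk_eleven_mul_ne_splitDiscriminantClassCM hR 17 (by norm_num) (u * v) (by rw [Units.val_mul, hu, hv]; norm_num))
  · exact mk_ne_mk_of_mk_mul_ne_split u v (sqrtNegThreePlusSqrtTwo_mk_eleven_mul_ne_splitDiscriminantClassCM hR 23 (by norm_num) (u * v) (by rw [Units.val_mul, hu, hv]; norm_num))
  · exact mk_ne_mk_of_mk_mul_ne_split u v (sqrtNegThreePlusSqrtTwo_mk_ne_splitDiscriminantClassCM_of_residue hR 363 (by decide) (u * v) (by rw [Units.val_mul, hu, hv]; norm_num))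
  · exact mk_ne_mk_of_mk_mul_ne_split u v (sqrtNegThreePlusSqrtTwo_mk_eleven_mul_ne_splitDiscriminantClassCM hR 39 (by norm_num) (u * v) (by rw [Units.val_mul, hu, hv]; norm_num))
  · exact mk_ne_mk_of_mk_mul_ne_split u v (sqrtNegThreePlusSqrtTwo_mk_five_mul_ne_splitDiscriminantClassCM hR 39 (by norm_num) (u * v) (by rw [Units.val_mul, hu, hv]; norm_num))
  · exact mk_ne_mk_of_mk_mul_ne_split u v (sqrtNegThreePlusSqrtTwo_mk_thirteen_mul_ne_splitDiscriminantClassCM hR 17 (by norm_num) (u * v) (by rw [Units.val_mul, hu, hv]; norm_num))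
  · exact mk_ne_mk_of_mk_mul_ne_split u v (sqrtNegThreePlusSqrtTwo_mk_thirteen_mul_ne_splitDiscriminantClassCM hR 23 (by norm_num) (u * v) (by rw [Units.val_mul, hu, hv]; norm_num))
  · exact mk_ne_mk_of_mk_mul_ne_split u v (sqrtNegThreePlusSqrtTwo_mk_eleven_mul_ne_splitDiscriminantClassCM hR 39 (by norm_num) (u * v) (by rw [Units.val_mul, hu, hv]; norm_num))
  · exact mk_ne_mk_of_mk_mul_ne_split u v (sqrtNegThreePlusSqrtTwo_mk_ne_splitDiscriminantClassCM_of_residue hR 507 (by decide) (u * v) (by rw [Units.val_mul, hu, hv]; norm_num))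
  · exact mk_ne_mk_of_mk_mul_ne_split u v (sqrtNegThreePlusSqrtTwo_mk_five_mul_ne_splitDiscriminantClassCM hR 51 (by norm_num) (u * v) (by rw [Units.val_mul, hu, hv]; norm_num))
  · exact mk_ne_mk_of_mk_mul_ne_split u v (sqrtNegThreePlusSqrtTwo_mk_five_mul_ne_splitDiscriminantClassCM hR 69 (by norm_num) (u * v) (by rw [Units.val_mul, hu, hv]; norm_num))
  · exact mk_ne_mk_of_mk_mul_ne_split u v (sqrtNegThreePlusSqrtTwo_mk_five_mul_ne_splitDiscriminantClassCM hR 99 (by norm_num) (u * v) (by rw [Units.val_mul, hu, hv]; norm_num))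
  · exact mk_ne_mk_of_mk_mul_ne_split u v (sqrtNegThreePlusSqrtTwo_mk_five_mul_ne_splitDiscriminantClassCM hR 117 (by norm_num) (u * v) (by rw [Units.val_mul, hu, hv]; norm_num))
  · exact mk_ne_mk_of_mk_mul_ne_split u v (sqrtNegThreePlusSqrtTwo_mk_twentyThree_mul_ne_splitDiscriminantClassCM hR 17 (by norm_num) (u * v) (by rw [Units.val_mul, hu, hv]; norm_num))
  · exact mk_ne_mk_of_mk_mul_ne_split u v (sqrtNegThreePlusSqrtTwo_mk_eleven_mul_ne_splitDiscriminantClassCM hR 51 (by norm_num) (u * v) (by rw [Units.val_mul, hu, hv]; norm_num))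
  · exact mk_ne_mk_of_mk_mul_ne_split u v (sqrtNegThreePlusSqrtTwo_mk_thirteen_mul_ne_splitDiscriminantClassCM hR 51 (by norm_num) (u * v) (by rw [Units.val_mul, hu, hv]; norm_num))
  · exact mk_ne_mk_of_mk_mul_ne_split u v (sqrtNegThreePlusSqrtTwo_mk_eleven_mul_ne_splitDiscriminantClassCM hR 69 (by norm_num) (u * v) (by rw [Units.val_mul, hu, hv]; norm_num))
  · exact mk_ne_mk_of_mk_mul_ne_split u v (sqrtNegThreePlusSqrtTwo_mk_thirteen_mul_ne_splitDiscriminantClassCM hR 69 (by norm_num) (u * v) (by rw [Units.val_mul, hu, hv]; norm_num))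
  · exact mk_ne_mk_of_mk_mul_ne_split u v (sqrtNegThreePlusSqrtTwo_mk_eleven_mul_ne_splitDiscriminantClassCM hR 117 (by norm_num) (u * v) (by rw [Units.val_mul, hu, hv]; norm_num))

/-- **ROW STRUCTURE of the integer classes `1 ≤ n ≤ 40` for `E = ℚ(√-(3+√2))`** (`R = S² + 6S + 7`): `[n₁] = [n₂]`
in `F^×/Nm_{E/F}(E^×)` — the discriminant classes `n₁`, `n₂` label the SAME component `W8.E.δ` of the census — **iff
`r(n₁) = r(n₂)`**, `r` the row map above; so these 40 classes lie on exactly 10 components, with least labels `[1,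
3, 5, 11, 13, 15, 17, 23, 33, 39]`. [cite: Deligne1982HodgeCycles, §4 p. 30 (1) and Cor. 4.2] [cite:
Landherr1936HermitianForms] -/
theorem sqrtNegThreePlusSqrtTwo_mk_eq_mk_iff_sameRow {n₁ r₁ n₂ r₂ : ℕ}
    (h₁ : (n₁, r₁) ∈ (
      {(1, 1), (2, 1), (3, 3), (4, 1), (5, 5), (6, 3), (7, 3), (8, 1), (9, 1), (10, 5), (11, 11), (12, 3),
       (13, 13), (14, 3), (15, 15), (16, 1), (17, 17), (18, 1), (19, 3), (20, 5), (21, 1), (22, 11), (23, 23),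
       (24, 3), (25, 1), (26, 13), (27, 3), (28, 3), (29, 1), (30, 15), (31, 3), (32, 1), (33, 33), (34, 17),
       (35, 15), (36, 1), (37, 1), (38, 3), (39, 39), (40, 5)} : Finset (ℕ × ℕ)))
    (h₂ : (n₂, r₂) ∈ (
      {(1, 1), (2, 1), (3, 3), (4, 1), (5, 5), (6, 3), (7, 3), (8, 1), (9, 1), (10, 5), (11, 11), (12, 3),
       (13, 13), (14, 3), (15, 15), (16, 1), (17, 17), (18, 1), (19, 3), (20, 5), (21, 1), (22, 11), (23, 23),
       (24, 3), (25, 1), (26, 13), (27, 3), (28, 3), (29, 1), (30, 15), (31, 3), (32, 1), (33, 33), (34, 17),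
       (35, 15), (36, 1), (37, 1), (38, 3), (39, 39), (40, 5)} : Finset (ℕ × ℕ)))
    (u v : (realField R)ˣ) (hu : (u : realField R) = n₁) (hv : (v : realField R) = n₂) :
    (QuotientGroup.mk u : cmNormResidueGroup R) = QuotientGroup.mk v ↔ r₁ = r₂ :=
  mk_eq_mk_iff_of_rowMap _ ({1, 3, 5, 11, 13, 15, 17, 23, 33, 39} : Finset ℕ) (sqrtNegThreePlusSqrtTwo_rowMap hR) (sqrtNegThreePlusSqrtTwo_reps_pairwise_ne hR) (by decide)
    h₁ h₂ u v hu hv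

end SqrtNegThreePlusSqrtTwo

end Summit.HodgeConjecture.HodgeConjecture.Ring2.WeilCoverageCM

end
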